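import Summits.QuantumFields.YangMills.Theorems.BalabanUVNodesN11Sect3SupplyChainBorelBThm1PrintedOfScalars

/-!
# DAG node N11 — BOREL 𝐁-TERMS ALONG THE WITNESS CHAIN, VII: the `SupplierBorel` road's printed output AT ANY H-EXTENSION OF A LIVE RE-PIN and AT THE ALL-NUMERICS
# WITNESS FAMILY `θ₁₃(n, ε₂₉)` — selector clause `rfl`, admissibility from `n.Pos ∧ 0 < ε₂₉`; what is displayed are NUMERALS OF `n` and the per-run rows

HEADER — WORK-UNIT METADATA.  Cell `pub-ymgap`, YM-PLAN Track A (D-0062 ∕ D-0149 width seats), seat `pub-ymgap-dag-n11-w1` (g2; WIDTH SEAT 1 of 4 on NODE n11 [B14]),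
route `BalabanUVNodes` rev 25, item K1⁷ `StabilityBAtRecordR13SepCoPH` = stmt-QuantumFields-20542 (helper, `--kind proof --supports 20542 --as helper`, count-neutral).
[III] = [Balaban1988Convergent], [15] = [Balaban1985Variational], [B16] = [Balaban1989LargeFieldII], [IV] = [Balaban1989LargeFieldI].  Over this seat's
`…BorelBThm1PrintedOfScalars` (FILE VI: the road from seven scalars + `L·M₂ ∣ M` + per-run `PartCompat₁₃` ∕ solvability ∕ supplier), K0a's `Node00/Record13LiveSelector`
(`Stage13Params.liveRepin₁₃`, `Admissible.liveRepin₁₃`) ∕ `Node00/Record13LiveSelectorFamily` (`theta13OfNumerics`, `theta13LiveOfNumerics`, `admissible_theta13OfNumerics`,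
the `rfl` dictionary `ν = n.ν`, `τ9 = n.τ9`, `s2 = n.s2`, `γ = n.γ`), in the H-extension-by-equation style of dag-n11-e's `…N11Sect3SupplyChainNodeAtNumerics`.

WHY THIS FILE.  FILE VI states N11's printed output for a generic `θ` with the live-selector line displayed (selector clause, admissibility, signs).  At any H-extension
`θ` of a live re-pin `θ₀.liveRepin₁₃ F N` the selector clause is `rfl` and admissibility is `θ₀`'s; at the ALL-NUMERICS FAMILY `θ₁₃(n, ε₂₉)` (K0a) admissibility is `n.Pos ∧
0 < ε₂₉` and EVERY remaining θ-level letter is a NUMERAL OF `n` — so the honest state of N11 on this road reads: `n.Pos`, `0 < ε₂₉`, `0 ≤ κ, E₀, B₀`, `0 < n.ν.M₁ ≤ n.τ9.M`,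
`2 ≤ n.s2.cR`, `L·n.ν.M₂ ∣ n.τ9.M`, `3·n.ν.M₁ ≤ L·n.ν.M₂`, `8L + 3 ≤ L·n.ν.M₂`, `0 < n.ν.A₀`, `n.γ < 1`, `n.γ ≤ e^{−n.ν.p₀}`, the two edge inequalities at `n.γ`, the
key `Provisos₁₃SepCoPH`, and per windowed run `PartCompat₁₃`, K0's per-cube [15]-solvability, [III] §3's supplier.  That list is what a numerics of record must meet for
THIS road (the witnesses of record have `cR = 1`: located, dag-n11-d g12 ∕ dag-n11-w3 INTENT-4).

WHAT THIS FILE PROVES (4 theorems, 0 `sorry`, 0 `def`; nothing of Bałaban asserted).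
§8 ★★★★ `sLaw₁₃CoPH_all_gaussPinH_liveRepinH_of_obligations_of_supplierBorel_of_nesting_of_scalars` ∕ ★★★★★
   `thm1Printed_datumOfRecord₁₃SepCoPH_gaussPinH_liveRepinH_of_supplierBorel_of_nesting_of_scalars` — at any `θ : Stage13HParams` with `θ.toStage13Params = θ₀.liveRepin₁₃ F N`:
   THEOREM 1 along the chain (one run) ∕ `B16.Thm1Printed` at the K1⁷-keyed datum of `gaussPinH θ`, letters on `θ₀`.
§9 ★★★★ `sLaw₁₃CoPH_all_gaussPinH_theta13LiveOfNumericsH_of_obligations_of_supplierBorel_of_nesting_of_scalars` ∕ ★★★★★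
   `thm1Printed_datumOfRecord₁₃SepCoPH_gaussPinH_theta13LiveOfNumericsH_of_supplierBorel_of_nesting_of_scalars` — the same at `θ.toStage13Params = θ₁₃(n, ε₂₉)`, letters on `n`.

HONEST FRAMING.  Helper lane of K1⁷; composition by name (`obtain rfl` on the keying equation, then FILE VI); nothing of [III] ∕ [15] ∕ [B16] asserted — the key, the
scalars, `PartCompat₁₃`, solvability and the supplier are HYPOTHESES; no numerics `n` meeting them is exhibited here (K0 ∕ node00-def-K0a's business; the record's `cR = 1`
fails `2 ≤ cR`).  N11 NOT discharged; K1⁷ NOT closed; counts unmoved (typed 28∕28 · discharged 5∕27).  R4 closes only the conditional finite-𝕋⁴ rung `BalabanLadder.UV` of one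
programme at fixed `ε = L^{−K}` — NOT ℝ⁴, NOT OS, NOT a mass gap, NOT Clay.  No `sorry`, `axiom`, `def`, `instance`, `notation`.  Sources (SHAPE only): [III] Thm 1 p.262,
Theorem p.245, §3 p.279, (3.22) p.269, (3.24)–(3.25) p.270, (0.2) p.244, (2.4)–(2.5) p.255; [B16] Thm 1 p.355; [IV] (0.3)–(0.4) p.176, p.177 (i)–(ii); [15] Thm 1 (7)–(8)
pp.278–279; [Balaban1987RG1] Thm 1 p.259, (0.21) p.256, (2.9) p.266.
-/

noncomputable section

open MeasureTheory
open scoped BigOperators ENNReal NNReal Matrix.Norms.L2Operator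

namespace Summit.QuantumFields.YangMills.Theorems.BalabanUVNodesN11Sect3SupplyChainBorelBThm1PrintedAtNumerics

open Literature.MathematicalPhysics.QuantumFieldTheory.Balaban1983to89 T4Continuum T4NestedCovariance Node00 Node00.Tk DagBinding
open B15DeterminingSets B8Eq17ClassAkV1 B14.Eq218Concrete B10Eq42TorusConstraint Step
open B14.Eq213MaximalDomains (side)
open B14.Eq213DetSet (Bj)
open Literature.MathematicalPhysics.QuantumFieldTheory.BalabanImbrieJaffe1984to88.BIJ85Eq453GaugeField (qsstarGIter0)
open BalabanUVNodesN11HistoryPinnedResidualDefs BalabanUVNodesN11RePinnedParamDefs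
open BalabanUVNodesN11GaussianCertificateRows
open BalabanUVNodesN11GaussianCertificateDefs (gaussPinH gaussPinH_ζ0 gaussPinH_quad provisos₁₃CoPH_gaussPinH)
open BalabanUVNodesN11Sect3SupplyChainDefs
open BalabanUVNodesN11Sect3SupplyChainBorelB
open BalabanUVNodesN11Sect3SupplyChainObligationsDefs
open BalabanUVNodesN11Sect3SupplyChainBorelBObligationsOfSolvable
open BalabanUVNodesN11Sect3SupplyChainBorelBThm1PrintedOfSolvable
open BalabanUVNodesN11Sect3SupplyChainBorelBThm1PrintedOfScalars

variable {F : T4Family} {N : ℕ} [NeZero N]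

/-! ## §8  At any H-extension of a live re-pin `θ₀.liveRepin₁₃ F N`: selector clause `rfl`, admissibility `hθ₀.liveRepin₁₃`, letters on `θ₀` -/

section Repin

variable {θ₀ : Stage13Params F N} {θ : Stage13HParams F N}

/-- **★★★★ THEOREM 1 OF [III] ALONG THE CHAIN AT `gaussPinH θ`, `θ` ANY H-EXTENSION OF A LIVE RE-PIN `θ₀.liveRepin₁₃ F N`, FROM SCALARS ON `θ₀`, `PartCompat₁₃`, K0's
SOLVABILITY AND THE SUPPLIER** (one run `p` in the window of length `K`): FILE VI's run-level face at the certificate with the selector clause `rfl` and admissibility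
`hθ₀.liveRepin₁₃`; signs and every scalar are `θ₀`'s (the re-pin changes the selector only). [cite: Balaban1988Convergent, Thm 1 p.262, Theorem p.245, §3 p.279, (3.22) p.269, (3.24)–(3.25) p.270; Balaban1989LargeFieldI, (0.3)–(0.4) p.176, p.177 (i)–(ii)] -/
theorem sLaw₁₃CoPH_all_gaussPinH_liveRepinH_of_obligations_of_supplierBorel_of_nesting_of_scalars {p : B12.RunParams}
    (hθ : θ.toStage13Params = θ₀.liveRepin₁₃ F N) (hθ₀ : θ₀.Admissible F N) (hκ : 0 ≤ θ₀.s2.lf.κ) (hE₀ : 0 ≤ θ₀.s2.lf.E₀) (hB₀ : 0 ≤ θ₀.s2.lf.B₀)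
    (h : θ.Provisos₁₃SepCoPH F N) (hM₁ : 0 < θ₀.ν.M₁) (hle : θ₀.ν.M₁ ≤ θ₀.τ9.M) (hcR : 2 ≤ θ₀.s2.cR)
    (hdiv : F.L * θ₀.ν.M₂ ∣ θ₀.τ9.M) (hM3 : 3 * θ₀.ν.M₁ ≤ F.L * θ₀.ν.M₂) (hMd : 8 * F.L + 3 ≤ F.L * θ₀.ν.M₂)
    (hA : 0 < θ₀.ν.A₀) (hγ1 : θ₀.γ < 1) (hγp : θ₀.γ ≤ Real.exp (-(θ₀.ν.p₀ : ℝ)))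
    (hg3 : (143 * ((((8 : ℕ) : ℝ)) ^ 2 / 4) ^ 2) * (θ₀.γ * (θ₀.ν.A₀ * (Real.log (θ₀.γ ^ 2)⁻¹) ^ θ₀.ν.p₀)) ≤ 1 / 3)
    (hg2 : 2 * (θ₀.γ * (θ₀.ν.A₀ * (Real.log (θ₀.γ ^ 2)⁻¹) ^ θ₀.ν.p₀)) ≤ 2 * ExpMeanLog.deltaSU (Fin N) / (((8 * F.L : ℕ) : ℝ)) ^ 2)
    (hw : Step.InInterval θ₀.γ p.K (gOfRecord₁₃ F N θ.toStage13Params p)) (hPC : PartCompat₁₃ F N θ.toStage13Params p p.K)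
    (hsolv : ∀ j, 1 ≤ j → j ≤ p.K →
      ∀ (s : SeqOfRecord F θ.toStage13Params.ν θ.toStage13Params.τ9.M (gOfRecord₁₃ F N θ.toStage13Params p) p.K j) (V : GaugeField (F.P p.K) j (SU N)),
      chiSeqOfRecord F N θ.toStage13Params.ν θ.toStage13Params.τ9.M (gOfRecord₁₃ F N θ.toStage13Params p) p.K j s V ≠ 0 →
      ∀ a ∈ cubesIn (fun a : ↥(cubeIndices (F.P p.K) (cubeSide (F.P p.K).L θ.toStage13Params.ν.M₂ (RkOfRecord (F.P p.K).L θ.toStage13Params.ν.r (gOfRecord₁₃ F N θ.toStage13Params p j)) j)) =>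
          cubeEnl (F.P p.K) (cubeSide (F.P p.K).L θ.toStage13Params.ν.M₂ (RkOfRecord (F.P p.K).L θ.toStage13Params.ν.r (gOfRecord₁₃ F N θ.toStage13Params p j)) j) a 0) (s.Ω j),
        ∃ U₀, IsMinimizer (avOfRecord F N p.K) {U | PlaqSmall (θ.toStage13Params.ν.εreg * (F.P p.K).eta j ^ 2) U}
          (Bj θ.toStage13Params.ν.M₁ (cubeEnl (F.P p.K) (cubeSide (F.P p.K).L θ.toStage13Params.ν.M₂ (RkOfRecord (F.P p.K).L θ.toStage13Params.ν.r (gOfRecord₁₃ F N θ.toStage13Params p j)) j) a 4) j)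
          (avgFamily (avOfRecord F N p.K) (qsstarGIter0 j V)) U₀)
    (σ : Sect3Supplier (gaussPinH θ) p) (hσ : SupplierObligations (gaussPinH θ) p σ) (hσB : SupplierBorel (gaussPinH θ) p σ) :
    ∀ k, k ≤ p.K → SLaw₁₃CoPH F N (gaussPinH θ) p k := by
  obtain ⟨⟨θ₁, Zr⟩, Zh, Phih⟩ := θ
  obtain rfl : θ₁ = _ := hθ
  exact sLaw₁₃CoPH_all_of_obligations_of_gaussCert_of_supplierBorel_of_nesting_of_scalars _ p (gaussPinH_ζ0 _) (gaussPinH_quad _) (provisos₁₃SepCoPH_gaussPinH h) rfl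
    hθ₀.liveRepin₁₃ hκ hE₀ hB₀ hM₁ hle hcR hdiv hM3 hMd hA hγ1 hγp hg3 hg2 hw hPC hsolv σ hσ hσB

/-- **★★★★★ `B16.Thm1Printed` AT THE K1⁷-KEYED DATUM OF `gaussPinH θ`, `θ` ANY H-EXTENSION OF A LIVE RE-PIN `θ₀.liveRepin₁₃ F N`, FROM SCALARS ON `θ₀` AND, PER WINDOWED
RUN, `PartCompat₁₃` + K0's SOLVABILITY + THE SUPPLIER** — FILE VI §7 ★★★★★ with the selector clause `rfl` and admissibility `hθ₀.liveRepin₁₃`.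
[cite: Balaban1988Convergent, Thm 1 p.262, Theorem p.245, §3 p.279, (3.22) p.269, (0.2) p.244; Balaban1989LargeFieldII, Thm 1 p.355; Balaban1987RG1, Thm 1 p.259; Balaban1989LargeFieldI, (0.3)–(0.4) p.176] -/
theorem thm1Printed_datumOfRecord₁₃SepCoPH_gaussPinH_liveRepinH_of_supplierBorel_of_nesting_of_scalars
    (hθ : θ.toStage13Params = θ₀.liveRepin₁₃ F N) (hθ₀ : θ₀.Admissible F N) (hκ : 0 ≤ θ₀.s2.lf.κ) (hE₀ : 0 ≤ θ₀.s2.lf.E₀) (hB₀ : 0 ≤ θ₀.s2.lf.B₀)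
    (h : θ.Provisos₁₃SepCoPH F N) (hM₁ : 0 < θ₀.ν.M₁) (hle : θ₀.ν.M₁ ≤ θ₀.τ9.M) (hcR : 2 ≤ θ₀.s2.cR)
    (hdiv : F.L * θ₀.ν.M₂ ∣ θ₀.τ9.M) (hM3 : 3 * θ₀.ν.M₁ ≤ F.L * θ₀.ν.M₂) (hMd : 8 * F.L + 3 ≤ F.L * θ₀.ν.M₂)
    (hA : 0 < θ₀.ν.A₀) (hγ1 : θ₀.γ < 1) (hγp : θ₀.γ ≤ Real.exp (-(θ₀.ν.p₀ : ℝ)))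
    (hg3 : (143 * ((((8 : ℕ) : ℝ)) ^ 2 / 4) ^ 2) * (θ₀.γ * (θ₀.ν.A₀ * (Real.log (θ₀.γ ^ 2)⁻¹) ^ θ₀.ν.p₀)) ≤ 1 / 3)
    (hg2 : 2 * (θ₀.γ * (θ₀.ν.A₀ * (Real.log (θ₀.γ ^ 2)⁻¹) ^ θ₀.ν.p₀)) ≤ 2 * ExpMeanLog.deltaSU (Fin N) / (((8 * F.L : ℕ) : ℝ)) ^ 2) {γ : ℝ} (hγ : 0 < γ)
    (hPC : ∀ P : B12.RunParams, Step.InInterval γ P.K (gOfRecord₁₃ F N θ.toStage13Params P) → PartCompat₁₃ F N θ.toStage13Params P P.K)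
    (hsolv : ∀ P : B12.RunParams, Step.InInterval γ P.K (gOfRecord₁₃ F N θ.toStage13Params P) → ∀ j, 1 ≤ j → j ≤ P.K →
      ∀ (s : SeqOfRecord F θ.toStage13Params.ν θ.toStage13Params.τ9.M (gOfRecord₁₃ F N θ.toStage13Params P) P.K j) (V : GaugeField (F.P P.K) j (SU N)),
      chiSeqOfRecord F N θ.toStage13Params.ν θ.toStage13Params.τ9.M (gOfRecord₁₃ F N θ.toStage13Params P) P.K j s V ≠ 0 →
      ∀ a ∈ cubesIn (fun a : ↥(cubeIndices (F.P P.K) (cubeSide (F.P P.K).L θ.toStage13Params.ν.M₂ (RkOfRecord (F.P P.K).L θ.toStage13Params.ν.r (gOfRecord₁₃ F N θ.toStage13Params P j)) j)) =>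
          cubeEnl (F.P P.K) (cubeSide (F.P P.K).L θ.toStage13Params.ν.M₂ (RkOfRecord (F.P P.K).L θ.toStage13Params.ν.r (gOfRecord₁₃ F N θ.toStage13Params P j)) j) a 0) (s.Ω j),
        ∃ U₀, IsMinimizer (avOfRecord F N P.K) {U | PlaqSmall (θ.toStage13Params.ν.εreg * (F.P P.K).eta j ^ 2) U}
          (Bj θ.toStage13Params.ν.M₁ (cubeEnl (F.P P.K) (cubeSide (F.P P.K).L θ.toStage13Params.ν.M₂ (RkOfRecord (F.P P.K).L θ.toStage13Params.ν.r (gOfRecord₁₃ F N θ.toStage13Params P j)) j) a 4) j)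
          (avgFamily (avOfRecord F N P.K) (qsstarGIter0 j V)) U₀)
    (σ : (P : B12.RunParams) → Sect3Supplier (gaussPinH θ) P)
    (hσ : ∀ P : B12.RunParams, Step.InInterval γ P.K (gOfRecord₁₃ F N θ.toStage13Params P) → SupplierObligations (gaussPinH θ) P (σ P))
    (hσB : ∀ P : B12.RunParams, Step.InInterval γ P.K (gOfRecord₁₃ F N θ.toStage13Params P) → SupplierBorel (gaussPinH θ) P (σ P)) :
    B16.Thm1Printed (datumOfRecord₁₃SepCoPH F N (gaussPinH θ) (provisos₁₃SepCoPH_gaussPinH h)).C := by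
  obtain ⟨⟨θ₁, Zr⟩, Zh, Phih⟩ := θ
  obtain rfl : θ₁ = _ := hθ
  exact thm1Printed_datumOfRecord₁₃SepCoPH_gaussPinH_of_supplierBorel_of_nesting_of_scalars _ h rfl hθ₀.liveRepin₁₃ hκ hE₀ hB₀ hM₁ hle hcR hdiv hM3 hMd hA hγ1 hγp
    hg3 hg2 hγ hPC hsolv σ hσ hσB

end Repin

/-! ## §9  At the all-numerics witness family `θ₁₃(n, ε₂₉) = theta13LiveOfNumerics F N n ε₂₉ ζ Rz Zt`: letters on `n` -/

section Numerics

variable {n : Stage12Numerics} {ε₂₉ : ℝ} {ζ : ZetaOfRecord F N n.ν n.τ9.M} {Rz : (K : ℕ) → Sect2.Residual (F.P K) (MatA N)}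
  {Zt : (K : ℕ) → TkResidualW F N (FluctV N) K} {θ : Stage13HParams F N}

/-- **★★★★ THEOREM 1 OF [III] ALONG THE CHAIN AT `gaussPinH θ`, `θ` ANY H-EXTENSION OF `θ₁₃(n, ε₂₉)`, FROM NUMERALS OF `n`** (one run in the window): `n.Pos`, `0 < ε₂₉`,
the three signs, `0 < n.ν.M₁ ≤ n.τ9.M`, `2 ≤ n.s2.cR`, `L·n.ν.M₂ ∣ n.τ9.M`, `3·n.ν.M₁ ≤ L·n.ν.M₂`, `8L + 3 ≤ L·n.ν.M₂`, `0 < n.ν.A₀`, `n.γ < 1`, `n.γ ≤ e^{−n.ν.p₀}`, the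
two edge inequalities; the key; `PartCompat₁₃`, K0's solvability, the supplier. [cite: Balaban1988Convergent, Thm 1 p.262, Theorem p.245, §3 p.279, (3.22) p.269, (2.4)–(2.5) p.255; Balaban1989LargeFieldI, (0.3)–(0.4) p.176; Balaban1987RG1, (0.21) p.256, (2.9) p.266] -/
theorem sLaw₁₃CoPH_all_gaussPinH_theta13LiveOfNumericsH_of_obligations_of_supplierBorel_of_nesting_of_scalars {p : B12.RunParams}
    (hθ : θ.toStage13Params = theta13LiveOfNumerics F N n ε₂₉ ζ Rz Zt) (hn : n.Pos) (hε' : 0 < ε₂₉)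
    (hκ : 0 ≤ n.s2.lf.κ) (hE₀ : 0 ≤ n.s2.lf.E₀) (hB₀ : 0 ≤ n.s2.lf.B₀)
    (h : θ.Provisos₁₃SepCoPH F N) (hM₁ : 0 < n.ν.M₁) (hle : n.ν.M₁ ≤ n.τ9.M) (hcR : 2 ≤ n.s2.cR)
    (hdiv : F.L * n.ν.M₂ ∣ n.τ9.M) (hM3 : 3 * n.ν.M₁ ≤ F.L * n.ν.M₂) (hMd : 8 * F.L + 3 ≤ F.L * n.ν.M₂)
    (hA : 0 < n.ν.A₀) (hγ1 : n.γ < 1) (hγp : n.γ ≤ Real.exp (-(n.ν.p₀ : ℝ)))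
    (hg3 : (143 * ((((8 : ℕ) : ℝ)) ^ 2 / 4) ^ 2) * (n.γ * (n.ν.A₀ * (Real.log (n.γ ^ 2)⁻¹) ^ n.ν.p₀)) ≤ 1 / 3)
    (hg2 : 2 * (n.γ * (n.ν.A₀ * (Real.log (n.γ ^ 2)⁻¹) ^ n.ν.p₀)) ≤ 2 * ExpMeanLog.deltaSU (Fin N) / (((8 * F.L : ℕ) : ℝ)) ^ 2)
    (hw : Step.InInterval n.γ p.K (gOfRecord₁₃ F N θ.toStage13Params p)) (hPC : PartCompat₁₃ F N θ.toStage13Params p p.K)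
    (hsolv : ∀ j, 1 ≤ j → j ≤ p.K →
      ∀ (s : SeqOfRecord F θ.toStage13Params.ν θ.toStage13Params.τ9.M (gOfRecord₁₃ F N θ.toStage13Params p) p.K j) (V : GaugeField (F.P p.K) j (SU N)),
      chiSeqOfRecord F N θ.toStage13Params.ν θ.toStage13Params.τ9.M (gOfRecord₁₃ F N θ.toStage13Params p) p.K j s V ≠ 0 →
      ∀ a ∈ cubesIn (fun a : ↥(cubeIndices (F.P p.K) (cubeSide (F.P p.K).L θ.toStage13Params.ν.M₂ (RkOfRecord (F.P p.K).L θ.toStage13Params.ν.r (gOfRecord₁₃ F N θ.toStage13Params p j)) j)) =>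
          cubeEnl (F.P p.K) (cubeSide (F.P p.K).L θ.toStage13Params.ν.M₂ (RkOfRecord (F.P p.K).L θ.toStage13Params.ν.r (gOfRecord₁₃ F N θ.toStage13Params p j)) j) a 0) (s.Ω j),
        ∃ U₀, IsMinimizer (avOfRecord F N p.K) {U | PlaqSmall (θ.toStage13Params.ν.εreg * (F.P p.K).eta j ^ 2) U}
          (Bj θ.toStage13Params.ν.M₁ (cubeEnl (F.P p.K) (cubeSide (F.P p.K).L θ.toStage13Params.ν.M₂ (RkOfRecord (F.P p.K).L θ.toStage13Params.ν.r (gOfRecord₁₃ F N θ.toStage13Params p j)) j) a 4) j)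
          (avgFamily (avOfRecord F N p.K) (qsstarGIter0 j V)) U₀)
    (σ : Sect3Supplier (gaussPinH θ) p) (hσ : SupplierObligations (gaussPinH θ) p σ) (hσB : SupplierBorel (gaussPinH θ) p σ) :
    ∀ k, k ≤ p.K → SLaw₁₃CoPH F N (gaussPinH θ) p k :=
  sLaw₁₃CoPH_all_gaussPinH_liveRepinH_of_obligations_of_supplierBorel_of_nesting_of_scalars (θ₀ := theta13OfNumerics F N n ε₂₉ ζ Rz Zt) hθ
    (admissible_theta13OfNumerics F N ζ Rz Zt hn hε') hκ hE₀ hB₀ h hM₁ hle hcR hdiv hM3 hMd hA hγ1 hγp hg3 hg2 hw hPC hsolv σ hσ hσB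

/-- **★★★★★ `B16.Thm1Printed` AT THE K1⁷-KEYED DATUM OF `gaussPinH θ`, `θ` ANY H-EXTENSION OF THE ALL-NUMERICS WITNESS `θ₁₃(n, ε₂₉)` — THE HONEST STATE OF N11 ON THE
`SupplierBorel` ROAD IN NUMERALS OF `n`.**  Displayed EXACTLY: `n.Pos`, `0 < ε₂₉`, `0 ≤ κ, E₀, B₀` (of `n.s2.lf`); the key `h : θ.Provisos₁₃SepCoPH`; `0 < n.ν.M₁ ≤ n.τ9.M`,
`2 ≤ n.s2.cR`, `L·n.ν.M₂ ∣ n.τ9.M`, `3·n.ν.M₁ ≤ L·n.ν.M₂`, `8L + 3 ≤ L·n.ν.M₂`, `0 < n.ν.A₀`, `n.γ < 1`, `n.γ ≤ e^{−n.ν.p₀}`, `143·(8²∕4)²·ε(n.γ) ≤ 1∕3`,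
`2ε(n.γ) ≤ 2δ_N∕(8L)²` (`ε(x) := x·n.ν.A₀·(log x⁻²)^{n.ν.p₀}`); SOME `γ > 0`; and PER RUN IN `]0, γ]`: `PartCompat₁₃` up to `K`, K0's per-cube [15]-solvability inside
`χ_j` (levels `1…K`), [III] §3's supplier AT THE CERTIFICATE with `SupplierObligations` + `SupplierBorel`.  Nothing else.
[cite: Balaban1988Convergent, Thm 1 p.262, Theorem p.245, §3 p.279, (3.22) p.269, (0.2) p.244, (2.4)–(2.5) p.255, (3.24)–(3.25) p.270; Balaban1989LargeFieldII, Thm 1 p.355; Balaban1987RG1, Thm 1 p.259, (0.21) p.256, (2.9) p.266; Balaban1989LargeFieldI, (0.3)–(0.4) p.176, p.177 (i)–(ii); Balaban1985Variational, Thm 1 (7)–(8) pp.278–279] -/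
theorem thm1Printed_datumOfRecord₁₃SepCoPH_gaussPinH_theta13LiveOfNumericsH_of_supplierBorel_of_nesting_of_scalars
    (hθ : θ.toStage13Params = theta13LiveOfNumerics F N n ε₂₉ ζ Rz Zt) (hn : n.Pos) (hε' : 0 < ε₂₉)
    (hκ : 0 ≤ n.s2.lf.κ) (hE₀ : 0 ≤ n.s2.lf.E₀) (hB₀ : 0 ≤ n.s2.lf.B₀)
    (h : θ.Provisos₁₃SepCoPH F N) (hM₁ : 0 < n.ν.M₁) (hle : n.ν.M₁ ≤ n.τ9.M) (hcR : 2 ≤ n.s2.cR)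
    (hdiv : F.L * n.ν.M₂ ∣ n.τ9.M) (hM3 : 3 * n.ν.M₁ ≤ F.L * n.ν.M₂) (hMd : 8 * F.L + 3 ≤ F.L * n.ν.M₂)
    (hA : 0 < n.ν.A₀) (hγ1 : n.γ < 1) (hγp : n.γ ≤ Real.exp (-(n.ν.p₀ : ℝ)))
    (hg3 : (143 * ((((8 : ℕ) : ℝ)) ^ 2 / 4) ^ 2) * (n.γ * (n.ν.A₀ * (Real.log (n.γ ^ 2)⁻¹) ^ n.ν.p₀)) ≤ 1 / 3)
    (hg2 : 2 * (n.γ * (n.ν.A₀ * (Real.log (n.γ ^ 2)⁻¹) ^ n.ν.p₀)) ≤ 2 * ExpMeanLog.deltaSU (Fin N) / (((8 * F.L : ℕ) : ℝ)) ^ 2) {γ : ℝ} (hγ : 0 < γ)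
    (hPC : ∀ P : B12.RunParams, Step.InInterval γ P.K (gOfRecord₁₃ F N θ.toStage13Params P) → PartCompat₁₃ F N θ.toStage13Params P P.K)
    (hsolv : ∀ P : B12.RunParams, Step.InInterval γ P.K (gOfRecord₁₃ F N θ.toStage13Params P) → ∀ j, 1 ≤ j → j ≤ P.K →
      ∀ (s : SeqOfRecord F θ.toStage13Params.ν θ.toStage13Params.τ9.M (gOfRecord₁₃ F N θ.toStage13Params P) P.K j) (V : GaugeField (F.P P.K) j (SU N)),
      chiSeqOfRecord F N θ.toStage13Params.ν θ.toStage13Params.τ9.M (gOfRecord₁₃ F N θ.toStage13Params P) P.K j s V ≠ 0 →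
      ∀ a ∈ cubesIn (fun a : ↥(cubeIndices (F.P P.K) (cubeSide (F.P P.K).L θ.toStage13Params.ν.M₂ (RkOfRecord (F.P P.K).L θ.toStage13Params.ν.r (gOfRecord₁₃ F N θ.toStage13Params P j)) j)) =>
          cubeEnl (F.P P.K) (cubeSide (F.P P.K).L θ.toStage13Params.ν.M₂ (RkOfRecord (F.P P.K).L θ.toStage13Params.ν.r (gOfRecord₁₃ F N θ.toStage13Params P j)) j) a 0) (s.Ω j),
        ∃ U₀, IsMinimizer (avOfRecord F N P.K) {U | PlaqSmall (θ.toStage13Params.ν.εreg * (F.P P.K).eta j ^ 2) U}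
          (Bj θ.toStage13Params.ν.M₁ (cubeEnl (F.P P.K) (cubeSide (F.P P.K).L θ.toStage13Params.ν.M₂ (RkOfRecord (F.P P.K).L θ.toStage13Params.ν.r (gOfRecord₁₃ F N θ.toStage13Params P j)) j) a 4) j)
          (avgFamily (avOfRecord F N P.K) (qsstarGIter0 j V)) U₀)
    (σ : (P : B12.RunParams) → Sect3Supplier (gaussPinH θ) P)
    (hσ : ∀ P : B12.RunParams, Step.InInterval γ P.K (gOfRecord₁₃ F N θ.toStage13Params P) → SupplierObligations (gaussPinH θ) P (σ P))
    (hσB : ∀ P : B12.RunParams, Step.InInterval γ P.K (gOfRecord₁₃ F N θ.toStage13Params P) → SupplierBorel (gaussPinH θ) P (σ P)) :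
    B16.Thm1Printed (datumOfRecord₁₃SepCoPH F N (gaussPinH θ) (provisos₁₃SepCoPH_gaussPinH h)).C :=
  thm1Printed_datumOfRecord₁₃SepCoPH_gaussPinH_liveRepinH_of_supplierBorel_of_nesting_of_scalars (θ₀ := theta13OfNumerics F N n ε₂₉ ζ Rz Zt) hθ
    (admissible_theta13OfNumerics F N ζ Rz Zt hn hε') hκ hE₀ hB₀ h hM₁ hle hcR hdiv hM3 hMd hA hγ1 hγp hg3 hg2 hγ hPC hsolv σ hσ hσB

end Numerics

end Summit.QuantumFields.YangMills.Theorems.BalabanUVNodesN11Sect3SupplyChainBorelBThm1PrintedAtNumerics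

end
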